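import Summits.ABC.IUTFork.Cor312LicenceDeepReal
import Summits.ABC.IUTFork.Conditional.AbcOfSGenuineAntecedent
import HarnessLib

/-!
# [IUTchIII] Cor. 3.12 — the (xi-f) LICENCE at the sharp real settings `settingDHVolSharp` / `settingPrVolSharp`
# FOLLOWS FROM ONE-FACTOR (Ind2)-MOVERS: the packet ASSEMBLY theorem

PROOF-ONLY record file (D-0012; 0 definitions, 0 `Prop` facts) of the abc-iut cell (WAVE-5 prover seat abc-iut-w5-d236,
gen 8; row «LICENCE-SHALLOW-RAMIFIED-KERNEL», STATUS 2026-08-26T09:05:40Z / split 09:59:56Z). TAKES NO SIDE on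
[IUTchIII] Cor. 3.12 (S. Mochizuki, *Inter-universal Teichmüller theory III*, kurims manuscript, Cor. 3.12 p. 173 l. 41 –
p. 174 l. 19; proof p. 174 l. 50 – p. 175 l. 1 «the holomorphic hull of the union of the possible images»; Step (xi) (xi-f)
p. 184 l. 26–27) or on any author.

CONTEXT (plan ruling C-R18, 2026-08-26T08:47:45Z, case (C)/(B-shallow) «not decided»; abc-iut-c312-3's MATH NOTE
08:51:10Z «the hull-level licence is INHABITED in a shallow-ramified window»). The deep refutations of the licence
(`Real.not_licence_settingDHVolSharp_of_deep`, abc-iut-w4-d026 p432372; odd-unramified `…_of_deep_unramified`, C-cert-2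
p433074) leave the SHALLOW packets. This file proves the ASSEMBLY half of the positive side, as pure packet algebra:

* §1 `Cor312.HullFrame.preimage_hullSet_subset_hull_ofComparison` — in the real frame pulled back along a comparison
  `e : X → Π_s K_s` (abc-iut-c312-7 `HullFrame.ofComparison`), the preimage of a hull-set `λ·𝒪_L` lies in the hull of
  ANY subset `U` as soon as every factor `s` carries some `u ∈ U` with `‖λ_s‖ ≤ ‖e(u)_s‖` (the hull is the
  intersection of the hull-sets containing `U`, or everything; NO `HullDefined`/volume input);
* §2 `Thm311.LogShells.exists_mem_Ind2Family_apply_eq` — an (Ind2)-automorphism at ONE `(j, v_ℚ)` extends by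
  identities to an (Ind2)-FAMILY (abc-iut-c312-1's `Ind2Family` is a product over `(j, v_ℚ)`);
* §3 **`Thm311.Real.qRegion_subset_thetaHull_settingDHVolSharp_of_movers`** — at abc-iut-c312-3's sharp real setting
  (Θ-boxes `ι_j(t_{Θ,j,v_j})·(R_I)^∼`, q-centre `ψ(ι_j(t_{q,v_j}))`, Dupuy–Hilado §3.9) and ANY label `j` and place
  `v_ℚ`: IF at every place `x | p` some `g ∈ Real.ismDH logv x` (Dupuy–Hilado's (Ind2): lattice isomorphisms of the
  log-shell `I_x`, §4.9) satisfies `‖t_{q,x}‖ ≤ ‖g(t_{Θ,j,x})‖` («MOVER hypothesis»; `g = 1` wherever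
  `‖t_{q,x}‖ ≤ ‖t_{Θ,j,x}‖`, e.g. off `S`), THEN `q-region ⊆ ⁿ˒°𝒰_{j,p}`. Mechanism: the point
  `x₀ = 1 ⊗ ⋯ ⊗ 1 ⊗ t_{Θ,j,v_j}` of the Θ-box at EVERY summand `v⃗`, moved by the (Ind2)-element acting by `g_{v_j}` on
  the LAST capsule slot and by `1` on the others (the typed `LogShells.Ind2 j v_ℚ` indexes its «independent copies
  of Ism» by (slot, place), [IUTchIII] Thm. 3.11 (i) (Ind2) p. 154), has factor norms `‖g(t_{Θ,j,v_j})‖ ≥ ‖t_{q,v_j}‖`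
  (`comparison_tprod`, `iota_eq_purePacket`, `norm_dEquiv_iota`), which are the q-centre norms;
* §4 **`licence_settingDHVolSharp_of_movers`** / **`licence_settingPrVolSharp_of_movers`** (abc-iut-c312-1's
  `Thm311ToCor312.Licence` at the labels of `𝔽_l^⋇`) and **`exists_qPinned_and_hull_settingPrVolSharp_of_movers`**
  (branch C's S_H antecedent «∃ ρ qK, QPinned ∧ PilotKummerCompatHull», C-cert-1 `exists_qPinned_and_hull_iff`, all
  labels; at the label `0` the Θ-idele is `1`, so the mover there is `‖t_{q,x}‖ ≤ ‖g 1‖`, e.g. `g = 1` for integral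
  `t_q`) — for ANY columns `col`.

The one-factor movers themselves are campaign-S / Team-R lattice algebra (abc-iut-w5-d180
`exists_mem_ismDH_apply_eq_of_primitive`, `logUnits_eq_closedBall_of_tame`; abc-iut-c312-3 «Cor312Ind2ShearRamified»):
at a tame place (`p > 2`, `e_v ≤ p − 2`, analytic logarithm, `log_p(𝒪_v^×) = 𝔪_v`) a Θ-idele with
`‖p‖^{k+1}·‖ϖ_v‖ < ‖t_Θ‖ ≤ ‖p‖^k·‖ϖ_v‖` is moved onto `p^k·ϖ_v`, so the mover hypothesis holds as soon as
`‖t_q‖ ≤ ‖p‖^k·‖ϖ_v‖` (c312-3's window `j²·ord_v(t_q) < e_v` is `k = 0`); that discharge is the companion file.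

HONEST SCOPE. Statements about OUR typed sharp containers (Θ-regions constant in `m`, no (Ind3)-enlargement beyond the
boxes) and Dupuy–Hilado's typed (Ind1)/(Ind2) (`logShellsDH`: capsule permutations and lattice isomorphisms of `I_v`);
the licence / hull readings are STRONGER-THAN-PRINT forms (ADJUDICATION-SPEC §2 (G1′)); where they HOLD, C-cert-1's
`thetaSide_of_exists_qPinned_and_hull_settingPrVolSharp` turns them into the typed Θ-side inequality at that setting —
nothing here bears on the printed GLOBAL inequality or asserts anything about the author's intended hull, and nothing
asserts or refutes [IUTchIII] Cor. 3.12. [cite: Mochizuki2012, IUTchIII Cor. 3.12 p.173–175, Thm. 3.11 (i) p.154, Step (xi)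
p.184] [cite: DupuyHilado2025, §3.9, §4.7, §4.9] [claim: Mochizuki2012, status: disputed] for every IUT sentence quoted.
typed ≠ proved; instantiated ≠ endorsed.
-/

noncomputable section

open Set Function
open scoped Pointwise

/-! ## 1. Frame lemma: a hull-set below the hull of `U` from one large element per factor -/

namespace Summit.ABC.IUTFork.Cor312.HullFrame

open Literature.IUT.LogVolume

variable {J : Type} [Fintype J] (K : J → Type) [∀ j, NontriviallyNormedField (K j)]
  [∀ j, IsUltrametricDist (K j)] [∀ j, ProperSpace (K j)]

/-- **A hull-set `λ·𝒪_L` lies in the hull of `U` as soon as every factor `s` carries some `u ∈ U` with `‖λ_s‖ ≤ ‖e(u)_s‖`**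
(real frame pulled back along `e`; [IUTchIII] Rmk. 3.9.5 (i): the hull is the smallest `λ'·𝒪_L ⊇ U`, or everything when `U`
is not relatively compact — and any `λ'·𝒪_L ⊇ U` has `‖λ'_s‖ ≥ ‖e(u)_s‖ ≥ ‖λ_s‖`). [cite: Mochizuki2012, IUTchIII Rmk. 3.9.5 (i) p. 127] -/
theorem preimage_hullSet_subset_hull_ofComparison {X : Type} (e : X → Π j, K j) (c : Π j, K j) (U : Set X)
    (h : ∀ j, ∃ u ∈ U, ‖c j‖ ≤ ‖e u j‖) :
    e ⁻¹' hullSet K c ⊆ (ofComparison K e).hull U := by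
  intro x hx
  unfold HullFrame.hull
  split_ifs with hb
  · refine Set.mem_sInter.2 ?_
    rintro H ⟨⟨H', ⟨c', -, rfl⟩, rfl⟩, hUH⟩
    rw [Set.mem_preimage, hullSet, mem_polydisc] at hx ⊢
    intro j
    obtain ⟨u, hu, hcu⟩ := h j
    have hu' : e u ∈ hullSet K c' := hUH hu
    rw [hullSet, mem_polydisc] at hu'
    exact (hx j).trans (hcu.trans (hu' j))
  · exact Set.mem_univ _

end Summit.ABC.IUTFork.Cor312.HullFrame

/-! ## 2. An (Ind2)-automorphism at one `(j, v_ℚ)` extends by identities to an (Ind2)-family -/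

namespace Summit.ABC.IUTFork.Thm311.LogShells

variable {T : ThetaIndex} (L : LogShells T)

/-- **(Ind2) at one packet extends to an (Ind2)-family**: abc-iut-c312-1's `Ind2Family` («independent copies of Ism»,
independently at every `(j, v_ℚ)`, [IUTchIII] Thm. 3.11 (i) (Ind2) p. 154) is a product over `(j, v_ℚ)`, so an element
of `Ind2 j v_ℚ` padded with identities is a member. [claim: Mochizuki2012, status: disputed] -/
theorem exists_mem_Ind2Family_apply_eq {j : T.Label} {vQ : T.VQ} {φ : L.Packet j vQ ≃ₗ[ℚ] L.Packet j vQ}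
    (hφ : φ ∈ L.Ind2 j vQ) : ∃ Φ ∈ L.Ind2Family, Φ j vQ = φ := by
  classical
  refine ⟨Function.update (fun j' => fun vQ' => LinearEquiv.refl ℚ (L.Packet j' vQ')) j
      (Function.update (fun vQ' => LinearEquiv.refl ℚ (L.Packet j vQ')) vQ φ), ?_, ?_⟩
  · intro j' vQ'
    by_cases hj : j' = j
    · subst hj
      rw [Function.update_self]
      by_cases hv : vQ' = vQ
      · subst hv
        rw [Function.update_self]
        exact hφ
      · rw [Function.update_of_ne hv]
        exact L.refl_mem_Ind2 j' vQ'
    · rw [Function.update_of_ne hj]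
      exact L.refl_mem_Ind2 j' vQ'
  · rw [Function.update_self, Function.update_self]

end Summit.ABC.IUTFork.Thm311.LogShells

/-! ## 3. The sharp real setting: q-region below the Θ-hull from one-factor movers -/

namespace Summit.ABC.IUTFork.Thm311.Real

open Cor312 Cor312.Setting Cor312Vol Literature.IUT.LogThetaLattice Literature.IUT.LogVolume NumberField IsDedekindDomain

variable {F : Type} [Field F] [NumberField F] (X : PilotData F) {logv : PadicLogs F} (hlog : LogvAnalytic logv)
  (M : Type) [Field M] [NumberField M]
  (archPk : ∀ (j : (thetaIndex X).Label) (vQ : (thetaIndex X).VQ), Set ((logShellsDH X logv).Packet j vQ))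
  (archSub : ∀ (j : (thetaIndex X).Label) (v : (thetaIndex X).V),
    Set ((logShellsDH X logv).Packet j ((thetaIndex X).over v)))
  (Ψ : ℤ → ∀ v : (thetaIndex X).V, v ∈ (thetaIndex X).Vbad → Set ((logShellsDH X logv).StarPacket v))
  (act : ℤ → ∀ v : (thetaIndex X).V, v ∈ (thetaIndex X).Vbad →
    (logShellsDH X logv).StarPacket v → Module.End ℚ ((logShellsDH X logv).StarPacket v))
  (Mmod : ℤ → ∀ j : (thetaIndex X).LabelStar, Set ((logShellsDH X logv).GlobalPacket j.1))
  (region : ℤ → ∀ j : (thetaIndex X).LabelStar, FinDivisor M → ∀ vQ : (thetaIndex X).VQ,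
    Set ((logShellsDH X logv).Packet j.1 vQ))
  (n : ℤ) {HT : Type} {LogLink : HT → HT → Type} {IsFull : ∀ {s t : HT}, LogLink s t → Prop}
  (lat : LGPGaussianLogThetaLattice LogLink IsFull)
  {Frd : Type} {IsoF : Frd → Frd → Type} {Ob : Frd → Type} {realify : Frd → Frd} {Strip : Type}
  {IsoS : Strip → Strip → Type} {Mv : ∀ v : (thetaIndex X).V, v ∈ (thetaIndex X).Vbad → Type}
  [∀ v h, Monoid (Mv v h)]
  (sig : GlobalLGPFrobenioidSignature (thetaIndex X).lstar (thetaIndex X).V (· ∈ (thetaIndex X).Vbad)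
    Frd IsoF Ob realify Strip IsoS Mv)
  (split : SplittingMonoids Mv) {ObΔ : Type} {N : ∀ v : (thetaIndex X).V, v ∈ (thetaIndex X).Vbad → Type}
  [∀ v h, Monoid (N v h)] (qData : QPilotData ObΔ N)
  (tq : ∀ (pp : Nat.Primes) (x : (thetaIndex X).Fibre (.inr pp)), haveI : Fact (pp : ℕ).Prime := ⟨pp.2⟩; kOf X pp.1 x)
  (t : ∀ (pp : Nat.Primes) (_ : Fin X.lstar) (x : (thetaIndex X).Fibre (.inr pp)),
    haveI : Fact (pp : ℕ).Prime := ⟨pp.2⟩; kOf X pp.1 x)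
  (htq0 : ∀ pp x, tq pp x ≠ 0)
  (htq1 : ∀ (pp : Nat.Primes) (x : (thetaIndex X).Fibre (.inr pp)),
    haveI : Fact (pp : ℕ).Prime := ⟨pp.2⟩; placeOf X pp.1 x ∉ X.S → ‖tq pp x‖ = 1)
  (col : ℤ → Column (logShellsDH X logv))

/-- **q-REGION ⊆ Θ-HULL AT `(j, v_ℚ)` FROM ONE-FACTOR MOVERS** (sharp real setting `settingDHVolSharp`): if at every place
`x | p` some `g ∈ Real.ismDH logv x` has `‖t_{q,x}‖ ≤ ‖g(t_{Θ,j,x})‖` (`t_{Θ,0,x} := 1`, `labelIdele`), then the q-pilot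
region at `(j, p)` lies in `ⁿ˒°𝒰_{j,p}`, the hull of the union of the possible images of the Θ-region; at `v_ℚ = ∞`
unconditionally (no field factor there). [claim: Mochizuki2012, status: disputed] [cite: DupuyHilado2025, §3.9, §4.9] -/
theorem qRegion_subset_thetaHull_settingDHVolSharp_of_movers (j : (thetaIndex X).Label) (vQ : (thetaIndex X).VQ)
    (hmov : ∀ (pp : Nat.Primes) (x : (thetaIndex X).Fibre (.inr pp)),
      haveI : Fact (pp : ℕ).Prime := ⟨pp.2⟩
      ∃ g ∈ ismDH logv x.1,
        ‖tq pp x‖ ≤ ‖(presAt X hlog pp).φ x (g (((presAt X hlog pp).φ x).symm (labelIdele X t pp j x)))‖) :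
    (settingDHVolSharp X hlog M archPk archSub Ψ act Mmod region n lat sig split qData tq t htq0 htq1).qRegion j vQ ⊆
      (settingDHVolSharp X hlog M archPk archSub Ψ act Mmod region n lat sig split qData tq t htq0 htq1).thetaHull j vQ := by
  set P := settingDHVolSharp X hlog M archPk archSub Ψ act Mmod region n lat sig split qData tq t htq0 htq1 with hP
  show factorMapDH X hlog j vQ ⁻¹' hullSet (factorFieldDH X hlog j vQ) (qCentreDH X hlog tq j vQ) ⊆
    (HullFrame.ofComparison (factorFieldDH X hlog j vQ) (factorMapDH X hlog j vQ)).hull (⋃₀ P.possibleImages j vQ)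
  refine HullFrame.preimage_hullSet_subset_hull_ofComparison (factorFieldDH X hlog j vQ) (factorMapDH X hlog j vQ) _ _ ?_
  cases vQ with
  | inl u => exact fun s => s.elim
  | inr pp =>
    haveI : Fact (pp : ℕ).Prime := ⟨pp.2⟩
    set L := logShellsDH X logv with hL
    set Pr := presAt X hlog pp with hPr
    -- the movers, acting on the LAST capsule slot only
    choose g hg hgn using hmov pp
    let G : (thetaIndex X).Caps j → ∀ x : (thetaIndex X).Fibre (.inr pp), L.carrier x.1 ≃ₗ[ℚ] L.carrier x.1 :=
      fun a x => if a = Fin.last _ then g x else LinearEquiv.refl ℚ _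
    have hG : ∀ a x, G a x ∈ L.ism x.1 := by
      intro a x
      by_cases ha : a = Fin.last _
      · simp only [G, if_pos ha]; exact hg x
      · simp only [G, if_neg ha]; exact L.one_mem_ism x.1
    obtain ⟨Φ, hΦ, hΦj⟩ := L.exists_mem_Ind2Family_apply_eq
      (show L.factorwise j (.inr pp) (fun a => L.summandwise (.inr pp) (G a)) ∈ L.Ind2 j (.inr pp) from ⟨G, hG, rfl⟩)
    have hΦind : Φ ∈ Setting.indGroup (situationDHVol X hlog M archPk archSub Ψ act Mmod region) :=
      Subgroup.subset_closure (Or.inr hΦ)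
    -- the point `x₀ = 1 ⊗ ⋯ ⊗ 1 ⊗ t_{Θ,j,v_j}` of the Θ-box at every summand
    let y : (thetaIndex X).Caps j → L.Packet1 (.inr pp) := fun a x =>
      (Pr.φ x).symm (Pi.mulSingle (M := fun _ : (thetaIndex X).Caps j => Pr.k x) (Fin.last _) (labelIdele X t pp j x) a)
    let x₀ : L.Packet j (.inr pp) := PiTensorProduct.tprod ℚ y
    have hcmp : ∀ e : (thetaIndex X).Caps j → (thetaIndex X).Fibre (.inr pp),
        Pr.comparison j x₀ e = iota pp.1 (Pr.kk e) (Fin.last _) (labelIdele X t pp j (e (Fin.last _))) := by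
      intro e
      rw [Pr.comparison_tprod, iota_eq_purePacket]
      refine congrArg (PiTensorProduct.tprod ℚ_[pp]) (funext fun a => ?_)
      rcases eq_or_ne a (Fin.last _) with rfl | ha
      · simp [y]
      · simp [y, Pi.mulSingle_eq_of_ne ha]
    have hx₀ : x₀ ∈ P.thetaRegion3 j (.inr pp) := by
      rw [hP, settingDHVolSharp, thetaRegion3_thetaBoxDH]
      show (fun z => Pr.factorMap j z) x₀ ∈ Pr.boxOf (sharpBoxDH X hlog t pp j)
      intro e
      refine ⟨Pr.comparison j x₀ e, ?_, fun i => rfl⟩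
      rw [hcmp e]
      exact ⟨1, Subring.one_mem _, mul_one _⟩
    -- the moved point and its factor norms
    have hu : Φ j (.inr pp) x₀ ∈ ⋃₀ P.possibleImages j (.inr pp) :=
      Set.mem_sUnion.2 ⟨_, ⟨Φ, hΦind, rfl⟩, Set.mem_image_of_mem _ hx₀⟩
    have hcmp' : ∀ e : (thetaIndex X).Caps j → (thetaIndex X).Fibre (.inr pp),
        Pr.comparison j (Φ j (.inr pp) x₀) e =
          iota pp.1 (Pr.kk e) (Fin.last _)
            (Pr.φ (e (Fin.last _)) (g _ ((Pr.φ (e (Fin.last _))).symm (labelIdele X t pp j (e (Fin.last _)))))) := by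
      intro e
      let y' : (thetaIndex X).Caps j → L.Packet1 (.inr pp) := fun a x => G a x (y a x)
      have hΦx : Φ j (.inr pp) x₀ = PiTensorProduct.tprod ℚ y' := by
        rw [hΦj]
        exact PiTensorProduct.congr_tprod (fun a => L.summandwise (.inr pp) (G a)) y
      rw [hΦx, Pr.comparison_tprod, iota_eq_purePacket]
      refine congrArg (PiTensorProduct.tprod ℚ_[pp]) (funext fun a => ?_)
      rcases eq_or_ne a (Fin.last _) with rfl | ha
      · simp [y', y, G]
        rfl
      · simp [y', y, G, ha]
    rintro ⟨e, i⟩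
    refine ⟨Φ j (.inr pp) x₀, hu, ?_⟩
    show ‖dEquiv pp.1 (Pr.kk e) (iota pp.1 (Pr.kk e) (Fin.last _) (tq pp (e (Fin.last _)))) i‖ ≤
      ‖dEquiv pp.1 (Pr.kk e) (Pr.comparison j (Φ j (.inr pp) x₀) e) i‖
    rw [hcmp' e, norm_dEquiv_iota, norm_dEquiv_iota]
    exact hgn _

/-! ## 4. The licence and branch C's hull-level antecedent from movers -/

/-- **THE (xi-f) LICENCE AT `settingDHVolSharp` FROM ONE-FACTOR MOVERS**: if at every prime `p`, label `j = i+1 ∈ 𝔽_l^⋇` and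
place `x | p` some `g ∈ Real.ismDH logv x` has `‖t_{q,x}‖ ≤ ‖g(t_{Θ,j,x})‖`, then abc-iut-c312-1's `Thm311ToCor312.Licence` holds
at abc-iut-c312-3's sharp real setting — the q-pilot region lies in `ⁿ˒°𝒰_{j,v_ℚ}` at every `(j, v_ℚ)`, `j ∈ 𝔽_l^⋇`.
[claim: Mochizuki2012, status: disputed] [cite: DupuyHilado2025, §3.9, §4.9] -/
theorem licence_settingDHVolSharp_of_movers
    (hmov : ∀ (pp : Nat.Primes) (i : Fin (thetaIndex X).lstar) (x : (thetaIndex X).Fibre (.inr pp)),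
      haveI : Fact (pp : ℕ).Prime := ⟨pp.2⟩
      ∃ g ∈ ismDH logv x.1,
        ‖tq pp x‖ ≤ ‖(presAt X hlog pp).φ x (g (((presAt X hlog pp).φ x).symm (t pp i x)))‖) :
    Thm311ToCor312.Licence (settingDHVolSharp X hlog M archPk archSub Ψ act Mmod region n lat sig split qData tq t htq0 htq1) := by
  intro i vQ
  refine qRegion_subset_thetaHull_settingDHVolSharp_of_movers X hlog M archPk archSub Ψ act Mmod region n lat sig split qData
    tq t htq0 htq1 (labelSucc i) vQ fun pp x => ?_
  haveI : Fact (pp : ℕ).Prime := ⟨pp.2⟩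
  rw [labelIdele_labelSucc]
  exact hmov pp i x

/-- **The same at the print-normalised sharp setting `settingPrVolSharp`** (abc-iut-c312-7; same regions, frames and
indeterminacies — `licence_settingPrVolSharp_iff_settingDHVolSharp`). [claim: Mochizuki2012, status: disputed] -/
theorem licence_settingPrVolSharp_of_movers
    (hmov : ∀ (pp : Nat.Primes) (i : Fin (thetaIndex X).lstar) (x : (thetaIndex X).Fibre (.inr pp)),
      haveI : Fact (pp : ℕ).Prime := ⟨pp.2⟩
      ∃ g ∈ ismDH logv x.1,
        ‖tq pp x‖ ≤ ‖(presAt X hlog pp).φ x (g (((presAt X hlog pp).φ x).symm (t pp i x)))‖) :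
    Thm311ToCor312.Licence (settingPrVolSharp X hlog M archPk archSub Ψ act Mmod region n lat sig split qData tq t htq0 htq1) := by
  rw [licence_settingPrVolSharp_iff_settingDHVolSharp]
  exact licence_settingDHVolSharp_of_movers X hlog M archPk archSub Ψ act Mmod region n lat sig split qData tq t htq0 htq1 hmov

/-- **BRANCH C's HULL-LEVEL ANTECEDENT «∃ ρ qK, QPinned ∧ PilotKummerCompatHull» IS INHABITED at `settingPrVolSharp` FROM MOVERS AT
EVERY LABEL** (any columns `col`; C-cert-1 `exists_qPinned_and_hull_iff`: the bundle is the inclusion q-region ⊆ Θ-hull at EVERY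
label `j ∈ {0,…,l⋇}`; at `j = 0` the Θ-idele is `1`, so there the mover reads `‖t_{q,x}‖ ≤ ‖g 1‖` — `g = 1` for `‖t_{q,x}‖ ≤ 1`).
[claim: Mochizuki2012, status: disputed] [cite: DupuyHilado2025, §3.9, §4.9] -/
theorem exists_qPinned_and_hull_settingPrVolSharp_of_movers
    (hmov : ∀ (pp : Nat.Primes) (j : (thetaIndex X).Label) (x : (thetaIndex X).Fibre (.inr pp)),
      haveI : Fact (pp : ℕ).Prime := ⟨pp.2⟩
      ∃ g ∈ ismDH logv x.1,
        ‖tq pp x‖ ≤ ‖(presAt X hlog pp).φ x (g (((presAt X hlog pp).φ x).symm (labelIdele X t pp j x)))‖) :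
    ∃ (ρ : (∀ v : (thetaIndex X).V, v ∈ (thetaIndex X).Vbad → Set ((logShellsDH X logv).StarPacket v)) →
          ∀ (j : (thetaIndex X).Label) (vQ : (thetaIndex X).VQ), Set ((logShellsDH X logv).Packet j vQ))
        (qK : ∀ v : (thetaIndex X).V, v ∈ (thetaIndex X).Vbad → Set ((logShellsDH X logv).StarPacket v)),
        QPinned ({ toSituation := situationPrVol X hlog M archPk archSub Ψ act Mmod region, col := col } :
            LatticeSituation (thetaIndex X))
          (settingPrVolSharp X hlog M archPk archSub Ψ act Mmod region n lat sig split qData tq t htq0 htq1) ρ qK ∧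
        PilotKummerCompatHull ({ toSituation := situationPrVol X hlog M archPk archSub Ψ act Mmod region, col := col } :
            LatticeSituation (thetaIndex X))
          (settingPrVolSharp X hlog M archPk archSub Ψ act Mmod region n lat sig split qData tq t htq0 htq1) ρ qK := by
  refine (Conditional.Antecedent.exists_qPinned_and_hull_iff
    ({ toSituation := situationPrVol X hlog M archPk archSub Ψ act Mmod region, col := col } : LatticeSituation (thetaIndex X))
    (settingPrVolSharp X hlog M archPk archSub Ψ act Mmod region n lat sig split qData tq t htq0 htq1)).2 fun j vQ => ?_
  exact qRegion_subset_thetaHull_settingDHVolSharp_of_movers X hlog M archPk archSub Ψ act Mmod region n lat sig split qData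
    tq t htq0 htq1 j vQ (hmov · j ·)

/-- **… hence the typed STATEMENT of Cor. 3.12 at `settingPrVolSharp`** (under the bridge hypotheses there, e.g. from `ThetaFinite`):
where the movers exist at the labels of `𝔽_l^⋇`, `−|log(q)| ≤ −|log(Θ)|` holds for OUR typed sharp containers — by monotonicity of
the log-volume (abc-iut-c312-6 `statement_of_licence`). A statement about OUR objects; no side taken. [claim: Mochizuki2012, status: disputed] -/
theorem statement_settingPrVolSharp_of_movers
    (HB : BridgeHyps (settingPrVolSharp X hlog M archPk archSub Ψ act Mmod region n lat sig split qData tq t htq0 htq1))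
    (hmov : ∀ (pp : Nat.Primes) (i : Fin (thetaIndex X).lstar) (x : (thetaIndex X).Fibre (.inr pp)),
      haveI : Fact (pp : ℕ).Prime := ⟨pp.2⟩
      ∃ g ∈ ismDH logv x.1,
        ‖tq pp x‖ ≤ ‖(presAt X hlog pp).φ x (g (((presAt X hlog pp).φ x).symm (t pp i x)))‖) :
    (settingPrVolSharp X hlog M archPk archSub Ψ act Mmod region n lat sig split qData tq t htq0 htq1).Statement :=
  Thm311ToCor312.statement_of_licence HB
    (licence_settingPrVolSharp_of_movers X hlog M archPk archSub Ψ act Mmod region n lat sig split qData tq t htq0 htq1 hmov)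

/-- **Trivial movers**: wherever `‖t_{q,x}‖ ≤ ‖t_{Θ,j,x}‖` the identity (`1 ∈ Real.ismDH`) is a mover — e.g. at the places off `S`
(both ideles units) and at the label `0` for integral `t_q`. [folklore] -/
theorem exists_mover_of_norm_le (pp : Nat.Primes) (j : (thetaIndex X).Label) (x : (thetaIndex X).Fibre (.inr pp))
    (h : haveI : Fact (pp : ℕ).Prime := ⟨pp.2⟩; ‖tq pp x‖ ≤ ‖labelIdele X t pp j x‖) :
    haveI : Fact (pp : ℕ).Prime := ⟨pp.2⟩
    ∃ g ∈ ismDH logv x.1,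
      ‖tq pp x‖ ≤ ‖(presAt X hlog pp).φ x (g (((presAt X hlog pp).φ x).symm (labelIdele X t pp j x)))‖ :=
  ⟨LinearEquiv.refl ℚ _, refl_mem_ismDH logv x.1, by
    simp only [LinearEquiv.refl_apply, LinearEquiv.apply_symm_apply]
    -- the two norms on `K_x` (the presentation's field instance / the rescaled completion's) agree definitionally
    exact le_of_le_of_eq h rfl⟩

end Summit.ABC.IUTFork.Thm311.Real

end
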